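import Mathlib
import Summits.Schanuel.Schanuel.Theorems.KhovanskiiApproxType.Negative.LoadBearing
import HarnessLib

/-!
# Route `DiophantineDichotomy`, crux `KhovanskiiApproxTypeEv` (stmt-Schanuel-14972), line `lambert-liouville-kill`:
# stub `stub_endgame` — rank-2 endgame (budget `n`, Liouville exponent `m`, final inequality)

Crux `Summit.Schanuel.Schanuel.Theses.DiophantineDichotomy.KhovanskiiApproxTypeEv` (item stmt-Schanuel-14972),
certificate line `lambert-liouville-kill` (skeleton `Cruxes/KhovanskiiApproxTypeEv/Lines/lambert_liouville_kill.lean`,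
lead `prover-line-stmt-Schanuel-14972-a1-0`), registered stub `stub_endgame` (landed `--supports stmt-Schanuel-14972`).

The final real inequality of the rank-2 certificate `notLiouville_lambert_of_ev`: for `a < 1`, `C > 0`,
`K ≥ 0` there is a degree budget `n ≥ 50` such that for every height-window exponent `M₀ > 0` some
Liouville exponent `m` and threshold `q₀` make the challenger's distance
`max (H^{−n/200}) (K q^{−m})` beat the crux's bound `exp(−C(nᵃ log H + nᵇ))` uniformly over
`q₀ ≤ q ≤ H ≤ q^{M₀}`.  Proof: with `a' := max a 0 < 1`, `b' := max b 0`, the PROVED tree lemma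
`Summit.Schanuel.Schanuel.Cruxes.KhovanskiiApproxType.Negative.exists_deg` gives `n ≥ 50` with
`C n^{a'} ≤ 0.003 n`, whence `C nᵃ log H ≤ 0.003 n log H`; the threshold `q₀ > exp(C n^{b'}/(0.002 n))`
gives `C nᵇ ≤ C n^{b'} < 0.002 n log q ≤ 0.002 n log H`, so `C(nᵃ log H + nᵇ) < (n/200) log H`, i.e.
`H^{−n/200} < exp(−C(…))`; and with `m := ⌈M₀ n/200⌉₊ + 1`, `q ≥ K + 1`:
`K q^{−m} ≤ q^{1−m} ≤ q^{−M₀ n/200} = (q^{M₀})^{−n/200} ≤ H^{−n/200}`.  Pure Mathlib real analysis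
(`Real.rpow_def_of_pos`, `Real.rpow_sub`, `Real.rpow_mul`, `Real.rpow_le_rpow_of_nonpos`).
-/

noncomputable section

-- `Summit.Schanuel.Schanuel.…` is the mandated summit/sub-problem namespace (single-conjunct summit), hence:
set_option linter.dupNamespace false

namespace Summit.Schanuel.Schanuel.Cruxes.KhovanskiiApproxTypeEv.LambertLiouvilleKill

open Polynomial
open Summit.Schanuel.Schanuel.Cruxes.KhovanskiiApproxType.Negative (exists_deg)

/-- First entry of the endgame: if the budget `n ≥ 1` satisfies `C n^{max a 0} ≤ 0.003 n` and the
height `H ≥ 1` satisfies `C n^{max b 0} < 0.002 n log H`, then `H^{−n/200} < exp(−C(nᵃ log H + nᵇ))`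
(compare exponents: `C nᵃ log H + C nᵇ < 0.003 n log H + 0.002 n log H = (n/200) log H`). [folklore] -/
theorem endgame_height_entry (a b C : ℝ) (n : ℕ) (hC : 0 < C) (hn1 : 1 ≤ n)
    (hn : C * (n : ℝ) ^ (max a 0) ≤ 3 / 1000 * n) (H : ℝ) (hH1 : 1 ≤ H)
    (hlog : C * (n : ℝ) ^ (max b 0) < 2 / 1000 * n * Real.log H) :
    H ^ (-((n : ℝ) / 200)) < Real.exp (-(C * ((n : ℝ) ^ a * Real.log H + (n : ℝ) ^ b))) := by
  have hn1r : (1 : ℝ) ≤ n := by exact_mod_cast hn1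
  have hH0 : 0 < H := by linarith
  have hlogH0 : 0 ≤ Real.log H := Real.log_nonneg hH1
  have hna : (n : ℝ) ^ a ≤ (n : ℝ) ^ (max a 0) :=
    Real.rpow_le_rpow_of_exponent_le hn1r (le_max_left _ _)
  have hnb : (n : ℝ) ^ b ≤ (n : ℝ) ^ (max b 0) :=
    Real.rpow_le_rpow_of_exponent_le hn1r (le_max_left _ _)
  have h1 : C * (n : ℝ) ^ a * Real.log H ≤ 3 / 1000 * n * Real.log H := by
    have : C * (n : ℝ) ^ a ≤ 3 / 1000 * n := (mul_le_mul_of_nonneg_left hna hC.le).trans hn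
    exact mul_le_mul_of_nonneg_right this hlogH0
  have h2 : C * (n : ℝ) ^ b ≤ C * (n : ℝ) ^ (max b 0) := mul_le_mul_of_nonneg_left hnb hC.le
  rw [Real.rpow_def_of_pos hH0, Real.exp_lt_exp]
  linarith

/-- Second entry of the endgame: for `0 ≤ K ≤ q`, `1 ≤ q ≤ H ≤ q^{M₀}` and `m ≥ M₀ n/200 + 1`,
`K q^{−m} ≤ q^{1−m} ≤ q^{−M₀ n/200} = (q^{M₀})^{−n/200} ≤ H^{−n/200}`. [folklore] -/
theorem endgame_liouville_entry (K M₀ : ℝ) (n m : ℕ) (q H : ℝ) (hKq : K ≤ q)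
    (hq1 : 1 ≤ q) (hm : M₀ * n / 200 + 1 ≤ (m : ℝ)) (hqH : q ≤ H) (hH : H ≤ q ^ M₀) :
    K * (1 / q ^ m) ≤ H ^ (-((n : ℝ) / 200)) := by
  have hq0 : 0 < q := by linarith
  have hH0 : 0 < H := by linarith
  have hn0 : (0 : ℝ) ≤ (n : ℝ) / 200 := by positivity
  calc K * (1 / q ^ m) ≤ q * (1 / q ^ m) := by
        apply mul_le_mul_of_nonneg_right hKq
        positivity
    _ = q ^ ((1 : ℝ) - (m : ℝ)) := by
        rw [Real.rpow_sub hq0, Real.rpow_one, Real.rpow_natCast]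
        ring
    _ ≤ q ^ (M₀ * (-((n : ℝ) / 200))) := by
        apply Real.rpow_le_rpow_of_exponent_le hq1
        linarith
    _ = (q ^ M₀) ^ (-((n : ℝ) / 200)) := Real.rpow_mul hq0.le _ _
    _ ≤ H ^ (-((n : ℝ) / 200)) := Real.rpow_le_rpow_of_nonpos hH0 hH (by linarith)

/-- **STUB 6 (rank-2 endgame: choice of the budget `n`, of the Liouville exponent `m`, final
inequality).**  For `a < 1`, `C > 0`, `K ≥ 0`: pick `n ≥ 50` with `C n^{max a 0} ≤ 0.003 n`
(`exists_deg`); given `M₀ > 0` put `m := ⌈M₀ n/200⌉₊ + 1` and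
`q₀ := max (max 2 (K + 1)) (exp (C n^{max b 0}/(0.002 n)) + 1)`; then for `q₀ ≤ q ≤ H ≤ q^{M₀}`:
`C(nᵃ log H + nᵇ) < (n/200) log H` (first entry, `endgame_height_entry`) and
`K q^{−m} ≤ q^{−M₀ n/200} ≤ H^{−n/200}` (second entry, `endgame_liouville_entry`). [folklore] -/
theorem stub_endgame :
    ∀ (a b C K : ℝ), a < 1 → 0 < C → 0 ≤ K → ∃ n : ℕ, 50 ≤ n ∧ ∀ M₀ : ℝ, 0 < M₀ →
      ∃ (m : ℕ) (q₀ : ℝ), ∀ (q H : ℝ), q₀ ≤ q → q ≤ H → H ≤ q ^ M₀ →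
        max (H ^ (-((n : ℝ) / 200))) (K * (1 / q ^ m)) <
          Real.exp (-(C * ((n : ℝ) ^ a * Real.log H + (n : ℝ) ^ b))) := by
  intro a b C K ha hC hK
  have ha'1 : max a 0 < 1 := max_lt ha one_pos
  obtain ⟨n, hn50, hn⟩ := exists_deg (max a 0) C ha'1 hC
  refine ⟨n, hn50, fun M₀ _hM₀ => ?_⟩
  have hn1 : 1 ≤ n := le_trans (by norm_num) hn50
  have hnpos : (0 : ℝ) < n := by exact_mod_cast (lt_of_lt_of_le (by norm_num) hn1)
  -- the threshold: q ≥ 2, q ≥ K + 1, log q > T := C n^{b'} / (0.002 n)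
  set T : ℝ := C * (n : ℝ) ^ (max b 0) / (2 / 1000 * n) with hT
  refine ⟨⌈M₀ * n / 200⌉₊ + 1, max (max 2 (K + 1)) (Real.exp T + 1), fun q H hq hqH hH => ?_⟩
  have hq2 : (2 : ℝ) ≤ q := le_trans (le_trans (le_max_left _ _) (le_max_left _ _)) hq
  have hKq : K + 1 ≤ q := le_trans (le_trans (le_max_right _ _) (le_max_left _ _)) hq
  have hTq : Real.exp T + 1 ≤ q := le_trans (le_max_right _ _) hq
  have hq0 : 0 < q := by linarith
  have hH1 : 1 ≤ H := by linarith
  -- first entry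
  have hTlt : T < Real.log q := by
    rw [Real.lt_log_iff_exp_lt hq0]
    linarith
  have hlogqH : Real.log q ≤ Real.log H := Real.log_le_log hq0 hqH
  have hlog : C * (n : ℝ) ^ (max b 0) < 2 / 1000 * n * Real.log H := by
    have h2n : (0 : ℝ) < 2 / 1000 * n := by positivity
    have h1 : T < Real.log H := lt_of_lt_of_le hTlt hlogqH
    rw [hT, div_lt_iff₀ h2n] at h1
    linarith
  have hfirst := endgame_height_entry a b C n hC hn1 hn H hH1 hlog
  -- second entry
  have hm : M₀ * n / 200 + 1 ≤ ((⌈M₀ * n / 200⌉₊ + 1 : ℕ) : ℝ) := by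
    push_cast
    linarith [Nat.le_ceil (M₀ * n / 200)]
  have hsecond := endgame_liouville_entry K M₀ n _ q H (by linarith) (by linarith) hm hqH hH
  exact max_lt hfirst (lt_of_le_of_lt hsecond hfirst)

end Summit.Schanuel.Schanuel.Cruxes.KhovanskiiApproxTypeEv.LambertLiouvilleKill

end
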